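/-
Copyright (c) 2026 the pub-hodgecm-mathlib formalisation cell (harness21).  Prover seat hodgecm-mathlib-K2Liu-p12 (g6), Track B «K2-LIT»,
#184♮ = hLiu418 = `stmt-HodgeConjecture-24832`; #42S block D, row D-2, (σ-A) mini-road ((σ-A) road desk K2Liu-p25 (g3) WORD #25∕#26∕#33: brick (an-3c-charts)),
FILE 2∕2 «CONE CHART FRAMES».  THEOREMS ONLY (no `def`, no `instance`, no `notation`, no named-fact hypothesis, no `sorry`).
-/
import Summits.HodgeConjecture.HodgeConjecture.Theorems.K2LiuAdaptedFrameOfMinor   -- ★ p864435 (an-3a) `exists_adaptedFrame`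
import Literature.NumberTheory.Weil1965.SplitPlaceSliceDensity                     -- ★ `SplitPlace.level`, `mem_shell_level`
import Literature.NumberTheory.Automorphic.LocalFieldHaarBalls                     -- ★ `LocalFieldHaar.measurable_normAbs`
import Literature.NumberTheory.Automorphic.QuaternionAlgebraHasse                  -- ★ `eq_zero_of_sq_sub_mul_sq_eq_zero` (anisotropy of `x² − d y²`)
import HarnessLib

/-!
# Crux `HLiu418`, socket #42S block D (row D-2, (σ-A) mini-road), brick (an-3c-charts) FILE 2∕2 `K2LiuConeChartFrames`:
# THE MULTIPLICATION GRAPH `ζ ↦ ζ·s`, ITS CHART FRAMES AT ONE SLOT EQUIVALENCE, AND THE LOWER-BOUND LETTER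

Cell `hodgecm-mathlib`, crux item hLiu418 = `stmt-HodgeConjecture-24832`; squad K2 ∕ K2Liu, road `K2_Liu`, socket #42S, block D row D-2; (σ-A) mini-road brick
(an-3c-charts).  Lane `--supports stmt-HodgeConjecture-24832 --as helper` (count-neutral helper; closes no socket by itself).

WHAT.  Over a non-archimedean local field `F` (record: `F := L⁺_v` at a NON-SPLIT place, `E_w = F(δ)`, `δ² = d` NOT a square), the position blocks
`F^{ι₁}`, `F^{ι₁′}` carry `n` quadratic coordinates each (`eJ : Fin n × Fin 2 ≃ ι₁`, `eJ′`: slot `(j, 0)` = `1`-part, `(j, 1)` = `δ`-part of the `j`-th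
`E_w`-coordinate), and the graph maps `Z_s : F² →ₗ F^{ι₁}` of ★ p864562 (an-3c) `coneWord_of_stageLetters` are, BY VALUE (`hZm`), the multiplication
`ζ ↦ ζ·s`, `(α + βδ)(x_j + y_jδ) = (αx_j + dβy_j) + (αy_j + βx_j)δ`.  THIS FILE delivers, at the consumer's ONE slot equivalence `eA : Fin 2 ⊕ ι₂ ≃ ι₁`
(desk WORD #33), exactly the letters of ★ p864562 and of K2Liu-p08's (I2) `K2LiuConeWordIntegrability.integrable_frameDensity`:
* `continuous_zm` = (I1)'s `hZc`; **`zm_lowerBound`** = `hZlow`: `∀ s ≠ 0, ∀ N ζ, Z_s ζ ∈ (𝔭^N)^{ι₁} → ζ ∈ (𝔭^{N − level s − c₀})²`, from the one arithmetic input — the LOWER-BOUND LETTER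
  of FILE 1 `K2LiuQuadraticCoordinateMultiplication.mem_primePowBall_of_mul_mem` (anisotropy of the norm form), taken BY VALUE as `hlow` with its constant
  `c₀` (`:= c₄ + 2|c_d|` at `F := K_v`) — applied at an `E_w`-coordinate of `s` of maximal size (`‖s_j‖ = q^{−level s}`, ★ `SplitPlace.mem_shell_level`);
* **`exists_coneChartFrames`** = `(A, hA, hres′, hAm, hdetm)`: a family of frames `A_s` with (i) `hA : ∀ s ≠ 0, ∀ t ζ, A_s t ⬝ᵥ Z_s ζ = t|_{eA,κ} ⬝ᵥ ζ`,
  (ii) the SUPPORT LETTER `hres′ : A_s(0 ⊔ b) ∈ (𝔭^N)^{ι₁} → b ∈ (𝔭^N)^{ι₂}` (the fibre coordinate is recovered at the chart's slots; block-D desk FLAG 3: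
  the literal `resR eA (A_s(0 ⊔ b)) = b` at the fixed `eA` is jointly unsatisfiable with (i)), (iii) `(s, b) ↦ A_s(0 ⊔ b)` measurable, (iv) `s ↦ |det A_s|`
  measurable.  CONSTRUCTION: at the chart `j` = the FIRST `E_w`-coordinate with `s_j ≠ 0`, the `2 × 2` minor of `Z_sᵀ` at the slots of `j` is
  `!![x_j, y_j; d y_j, x_j]`, `det = x_j² − d y_j² = N(s_j) ≠ 0` (ANISOTROPY, ★ `eq_zero_of_sq_sub_mul_sq_eq_zero`); ★ p864435 (an-3a) `exists_adaptedFrame` at a slot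
  equivalence `e′_j` through those slots (`exists_slotEquiv`) gives `A′_{j,s}`, and the coordinate relabelling `P_j := funCongrLeft ((e′_j)⁻¹ ∘ eA)` transports
  it to `eA` (`transport_frame`: `resL e′_j (P_j t) = resL eA t`); measurability is piecewise over the finitely many charts (`measurable_select`) with the
  explicit inverse `inv_minor` and ★ `LocalFieldHaar.measurable_normAbs`.
[cite: WeilBNT1967, Chap. I §2, Th. 3 Cor. 3; Chap. II §2, Def. 2] [cite: KudlaRallis1994, §2 (2.10)–(2.12)] [cite: Omeara1963, §63B (63:1)–(63:3)]
HONEST LABEL.  Count-neutral helper; it retires nothing by itself: `HC_CM` is proved only modulo the 7 printed citations (2 remaining named inputs: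
hLiu418 = `stmt-HodgeConjecture-24832`, h413 = `stmt-HodgeConjecture-24833`) until rung 0 closes.

## References
* [WeilBNT1967] A. Weil, *Basic Number Theory* (1967), Chap. I §2 (modules of automorphisms of `K^n`), Chap. II §2 Def. 2 (boxes and levels).
* [KudlaRallis1994] S. Kudla, S. Rallis, *A regularized Siegel–Weil formula: the first term identity*, Ann. of Math. 140 (1994), §2 (2.10)–(2.12).
* [Omeara1963] O. T. O'Meara, *Introduction to Quadratic Forms* (1963), §63B (anisotropy of the norm form of an unramified∕ramified quadratic extension).
-/

set_option autoImplicit false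
set_option linter.dupNamespace false -- the mandated namespace repeats `HodgeConjecture.HodgeConjecture`

noncomputable section

open Matrix MeasureTheory Set
open scoped NNReal
open Literature.NumberTheory.Automorphic
open Literature.NumberTheory.GaloisRepresentations Literature.NumberTheory.GaloisRepresentations.IsNonarchimedeanLocalField
open Literature.NumberTheory.Weil1965.SplitPlace (level mem_shell_level exists_normAbs_apply_eq_of_mem_shell)
open Summit.HodgeConjecture.HodgeConjecture.Cruxes.HLiu418

namespace Summit.HodgeConjecture.HodgeConjecture.Cruxes.HLiu418.K2LiuConeChartFrames

/-! ## §1 Slot equivalences and the transport of frames between them -/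

section Slots

variable {F : Type*} [Field F] {κ ι₂ ι₁ : Type*}

/-- **every pair of slots extends to a slot equivalence**: given ONE `eA : κ ⊕ ι₂ ≃ ι₁` (so `|ι₁| = |κ| + |ι₂|`) and an embedding `u : κ ↪ ι₁`, there is
`e′ : κ ⊕ ι₂ ≃ ι₁` with `e′ (inl c) = u c`. [cite: WeilBNT1967, Chap. I §2] -/
theorem exists_slotEquiv [Fintype κ] [Fintype ι₂] [Fintype ι₁] (eA : κ ⊕ ι₂ ≃ ι₁) (u : κ ↪ ι₁) :
    ∃ e' : κ ⊕ ι₂ ≃ ι₁, ∀ c, e' (Sum.inl c) = u c := by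
  classical
  have hcard : Fintype.card ι₂ = Fintype.card ((Set.range u)ᶜ : Set ι₁) := by
    rw [Fintype.card_compl_set, Set.card_range_of_injective u.injective, ← Fintype.card_congr eA, Fintype.card_sum,
      Nat.add_sub_cancel_left]
  exact ⟨(Equiv.sumCongr (Equiv.ofInjective u u.injective) (Fintype.equivOfCardEq hcard)).trans (Equiv.Set.sumCompl (Set.range u)),
    fun c => by simp [Equiv.Set.sumCompl_apply_inl]⟩

/-- the coordinate relabelling `P := funCongrLeft (e′⁻¹ ∘ e)` carries `e`-left coordinates to `e′`-left coordinates: `resL e′ (P t) = resL e t`.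
[cite: WeilBNT1967, Chap. I §2] -/
theorem resL_transport (e e' : κ ⊕ ι₂ ≃ ι₁) (t : ι₁ → F) :
    resL e' (LinearEquiv.funCongrLeft F F (e'.symm.trans e) t) = resL e t :=
  funext fun k => congrArg (fun x => t (e x)) (e'.symm_apply_apply (Sum.inl k))

/-- … and right coordinates: `resR e′ (P t) = resR e t`. [cite: WeilBNT1967, Chap. I §2] -/
theorem resR_transport (e e' : κ ⊕ ι₂ ≃ ι₁) (t : ι₁ → F) :
    resR e' (LinearEquiv.funCongrLeft F F (e'.symm.trans e) t) = resR e t :=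
  funext fun k => congrArg (fun x => t (e x)) (e'.symm_apply_apply (Sum.inr k))

/-- … hence glued vectors to glued vectors: `P (a ⊔_e b) = a ⊔_{e′} b`. [cite: WeilBNT1967, Chap. I §2] -/
theorem transport_glue (e e' : κ ⊕ ι₂ ≃ ι₁) (a : κ → F) (b : ι₂ → F) :
    LinearEquiv.funCongrLeft F F (e'.symm.trans e) (glue e a b) = glue e' a b :=
  funext fun i => congrArg (Sum.elim a b) (e.symm_apply_apply (e'.symm i))

/-- **TRANSPORT OF AN ADAPTED FRAME**: if `A′` is adapted to `Z` at the slot equivalence `e′` (`A′ t ⬝ᵥ Z ζ = resL e′ t ⬝ᵥ ζ`), then `A′ ∘ P` with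
`P := funCongrLeft (e′⁻¹ ∘ e)` is adapted to `Z` at `e` — ★ p864562's `hA` at the consumer's ONE `eA` from a chart frame at ANY slots.
[cite: WeilBNT1967, Chap. I §2, Th. 3 Cor. 3] -/
theorem transport_frame [Fintype κ] [Fintype ι₁] {Z : (κ → F) →ₗ[F] (ι₁ → F)} (e e' : κ ⊕ ι₂ ≃ ι₁) {A' : (ι₁ → F) ≃ₗ[F] (ι₁ → F)}
    (hA' : ∀ (t : ι₁ → F) (ζ : κ → F), A' t ⬝ᵥ Z ζ = resL e' t ⬝ᵥ ζ) (t : ι₁ → F) (ζ : κ → F) :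
    ((LinearEquiv.funCongrLeft F F (e'.symm.trans e)).trans A') t ⬝ᵥ Z ζ = resL e t ⬝ᵥ ζ := by
  rw [LinearEquiv.trans_apply, hA', resL_transport]

/-- **a finite selector of measurable pieces is measurable**: if `sel : X → O` has measurable fibres (`O` countable) and each `Ψ o` is measurable, then
`x ↦ Ψ (sel x) x` is measurable. [cite: WeilBNT1967, Chap. II §2] -/
theorem measurable_select {X Y O : Type*} [MeasurableSpace X] [MeasurableSpace Y] [Countable O]
    (sel : X → O) (hsel : ∀ o, MeasurableSet (sel ⁻¹' {o})) (Ψ : O → X → Y) (hΨ : ∀ o, Measurable (Ψ o)) :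
    Measurable fun x => Ψ (sel x) x := by
  intro T hT
  have h : (fun x => Ψ (sel x) x) ⁻¹' T = ⋃ o, (sel ⁻¹' {o} ∩ Ψ o ⁻¹' T) := by
    ext x
    simp only [Set.mem_preimage, Set.mem_iUnion, Set.mem_inter_iff, Set.mem_singleton_iff]
    exact ⟨fun hx => ⟨sel x, rfl, hx⟩, fun ⟨o, ho, hx⟩ => ho ▸ hx⟩
  rw [h]
  exact MeasurableSet.iUnion fun o => (hsel o).inter (hΨ o hT)

end Slots

/-! ## §2 The quadratic-coordinate multiplication graph: its minors, their anisotropy, their inverses -/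

section Minor

variable {F : Type*} [Field F] {n : ℕ} {ι₁ ι₁' ι₂ : Type*}
  (eJ : Fin n × Fin 2 ≃ ι₁) (eJ' : Fin n × Fin 2 ≃ ι₁') (d : F)
  (Zm : (ι₁' → F) → ((Fin 2 → F) →ₗ[F] (ι₁ → F)))
  (hZm : ∀ (s : ι₁' → F) (ζ : Fin 2 → F) (j : Fin n),
    Zm s ζ (eJ (j, 0)) = ζ 0 * s (eJ' (j, 0)) + d * ζ 1 * s (eJ' (j, 1)) ∧
    Zm s ζ (eJ (j, 1)) = ζ 0 * s (eJ' (j, 1)) + ζ 1 * s (eJ' (j, 0)))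

include hZm in
/-- the `2 × 2` minor of `Z_sᵀ` at the two slots of the `j`-th `E_w`-coordinate is `!![x_j, y_j; d·y_j, x_j]` (rows: `ζ = 1`, `ζ = δ`), in (an-3a)'s
`hZJ` letter shape at any slot equivalence `e′` through those slots. [cite: KudlaRallis1994, §2 (2.10)–(2.12)] -/
theorem minor_apply (s : ι₁' → F) (j : Fin n) (e' : Fin 2 ⊕ ι₂ ≃ ι₁) (he' : ∀ c, e' (Sum.inl c) = eJ (j, c)) (k k' : Fin 2) :
    (!![s (eJ' (j, 0)), s (eJ' (j, 1)); d * s (eJ' (j, 1)), s (eJ' (j, 0))] : Matrix (Fin 2) (Fin 2) F) k k' =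
      Zm s (Pi.single k 1) (e' (Sum.inl k')) := by
  rw [he']
  fin_cases k <;> fin_cases k' <;> simp [fun ζ => (hZm s ζ j).1, fun ζ => (hZm s ζ j).2]

/-- its determinant is the norm `x_j² − d·y_j² = N(x_j + y_jδ)`. [cite: Omeara1963, §63B] -/
theorem det_minor (x y : F) : (!![x, y; d * y, x] : Matrix (Fin 2) (Fin 2) F).det = x ^ 2 - d * y ^ 2 := by
  rw [Matrix.det_fin_two_of]
  ring

/-- its inverse is `N(s_j)⁻¹ · !![x_j, −y_j; −d·y_j, x_j]` — entries RATIONAL in `s`, which is what makes the frames measurable. [cite: WeilBNT1967, Chap. I §2] -/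
theorem inv_minor (x y : F) :
    (!![x, y; d * y, x] : Matrix (Fin 2) (Fin 2) F)⁻¹ = (x ^ 2 - d * y ^ 2)⁻¹ • !![x, -y; -(d * y), x] := by
  rw [Matrix.inv_def, Matrix.det_fin_two_of, Matrix.adjugate_fin_two_of, Ring.inverse_eq_inv',
    show x * x - y * (d * y) = x ^ 2 - d * y ^ 2 by ring]

/-- the inverse minor applied to a vector, in closed form: `(!![x, y; d y, x])⁻¹ w = N⁻¹ · (x w₀ − y w₁, x w₁ − d y w₀)`. [cite: WeilBNT1967, Chap. I §2] -/
theorem inv_minor_mulVec (x y : F) (w : Fin 2 → F) :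
    (!![x, y; d * y, x] : Matrix (Fin 2) (Fin 2) F)⁻¹ *ᵥ w =
      ![(x ^ 2 - d * y ^ 2)⁻¹ * (x * w 0 - y * w 1), (x ^ 2 - d * y ^ 2)⁻¹ * (x * w 1 - d * y * w 0)] := by
  rw [inv_minor]
  funext k
  fin_cases k <;> simp [Matrix.mulVec, dotProduct, Fin.sum_univ_two, Matrix.smul_apply] <;> ring

include hZm in
/-- `(s, ζ) ↦ Z_s ζ` is (jointly) continuous — every coordinate is a polynomial; = (I1) ★ `integrable_vectorAlongGraph`'s letter `hZc`.
[cite: WeilBNT1967, Chap. I §2] -/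
theorem continuous_zm [TopologicalSpace F] [ContinuousAdd F] [ContinuousMul F] :
    Continuous fun p : (ι₁' → F) × (Fin 2 → F) => Zm p.1 p.2 := by
  refine continuous_pi fun i => ?_
  obtain ⟨⟨j, c⟩, rfl⟩ := eJ.surjective i
  fin_cases c
  · exact (continuous_congr fun p : (ι₁' → F) × (Fin 2 → F) => (hZm p.1 p.2 j).1).2 (by fun_prop)
  · exact (continuous_congr fun p : (ι₁' → F) × (Fin 2 → F) => (hZm p.1 p.2 j).2).2 (by fun_prop)

include hZm in
/-- every coordinate of `Z_s ζ` is continuous in `s`. [cite: WeilBNT1967, Chap. I §2] -/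
theorem continuous_zm_apply [TopologicalSpace F] [ContinuousAdd F] [ContinuousMul F] (ζ : Fin 2 → F) (i : ι₁) :
    Continuous fun s : ι₁' → F => Zm s ζ i :=
  ((continuous_apply i).comp (continuous_zm eJ eJ' d Zm hZm)).comp (continuous_id.prodMk continuous_const)

end Minor

/-! ## §3 The lower-bound letter `hZlow` of (I2)∕(an-3b): `Z_s ζ` small ⇒ `ζ` small by the level of `s` -/

section LowerBound

variable {F : Type*} [Field F] [ValuativeRel F] [TopologicalSpace F] [IsNonarchimedeanLocalField F]
  {n : ℕ} {ι₁ ι₁' : Type*} [Fintype ι₁'] [Nonempty ι₁']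
  (eJ : Fin n × Fin 2 ≃ ι₁) (eJ' : Fin n × Fin 2 ≃ ι₁') (d : F)
  (Zm : (ι₁' → F) → ((Fin 2 → F) →ₗ[F] (ι₁ → F)))
  (hZm : ∀ (s : ι₁' → F) (ζ : Fin 2 → F) (j : Fin n),
    Zm s ζ (eJ (j, 0)) = ζ 0 * s (eJ' (j, 0)) + d * ζ 1 * s (eJ' (j, 1)) ∧
    Zm s ζ (eJ (j, 1)) = ζ 0 * s (eJ' (j, 1)) + ζ 1 * s (eJ' (j, 0)))

include hZm in
/-- **THE LOWER-BOUND LETTER `hZlow`** of K2Liu-p08's (I2) `integrable_frameDensity` ∕ ★ p864503 (an-3b) `fibreMass_box_le`'s `hZ`: given FILE 1's letter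
`hlow` (`q^{−ℓ} ≤ max(|x|,|y|)`, `αx + dβy, αy + βx ∈ 𝔭^K ⇒ α, β ∈ 𝔭^{K − ℓ − c₀}`; at `F := K_v`: ★ `K2LiuQuadraticCoordinateMultiplication.mem_primePowBall_of_mul_mem`
with `c₀ = c₄ + 2|c_d|`), for every `s ≠ 0`, `N`, `ζ`: `Z_s ζ ∈ (𝔭^N)^{ι₁} ⇒ ζ ∈ (𝔭^{N − level s − c₀})²` — read at an `E_w`-coordinate `j` of `s` carrying a
coordinate of maximal size `q^{−level s}` (★ `SplitPlace.mem_shell_level`). [cite: WeilBNT1967, Chap. II §2, Def. 2] [cite: Omeara1963, §63B] -/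
theorem zm_lowerBound (c₀ : ℤ)
    (hlow : ∀ ⦃α β x y : F⦄ ⦃Kx ℓ : ℤ⦄, ((residueFieldCard F : ℝ≥0)⁻¹) ^ ℓ ≤ max (normAbs F x) (normAbs F y) →
      α * x + d * β * y ∈ primePowBall F Kx → α * y + β * x ∈ primePowBall F Kx →
      α ∈ primePowBall F (Kx - ℓ - c₀) ∧ β ∈ primePowBall F (Kx - ℓ - c₀))
    (s : ι₁' → F) (hs : s ≠ 0) (N : ℤ) (ζ : Fin 2 → F) (hζ : Zm s ζ ∈ piPrimePowBall F ι₁ N) :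
    ζ ∈ piPrimePowBall F (Fin 2) (N - level s - c₀) := by
  obtain ⟨i, hi⟩ := exists_normAbs_apply_eq_of_mem_shell (mem_shell_level hs)
  obtain ⟨⟨j, c⟩, rfl⟩ := eJ'.surjective i
  have hxy : ((residueFieldCard F : ℝ≥0)⁻¹) ^ level s ≤ max (normAbs F (s (eJ' (j, 0)))) (normAbs F (s (eJ' (j, 1)))) := by
    fin_cases c
    · exact le_max_of_le_left (le_of_eq (by simpa using hi.symm))
    · exact le_max_of_le_right (le_of_eq (by simpa using hi.symm))
  have h1 := mem_piPrimePowBall_iff.1 hζ (eJ (j, 0)); have h2 := mem_piPrimePowBall_iff.1 hζ (eJ (j, 1))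
  rw [(hZm s ζ j).1] at h1; rw [(hZm s ζ j).2] at h2
  obtain ⟨hα, hβ⟩ := hlow hxy h1 h2
  exact mem_piPrimePowBall_iff.2 fun k => by fin_cases k <;> first | exact hα | exact hβ

end LowerBound

/-! ## §4 The chart frames at ONE slot equivalence: `(A, hA, hres′, hAm, hdetm)` -/

section Frames

variable {F : Type*} [Field F] [ValuativeRel F] [TopologicalSpace F] [IsNonarchimedeanLocalField F]
  [MeasurableSpace F] [BorelSpace F]
  {n : ℕ} {ι₁ ι₁' ι₂ : Type*} [Fintype ι₁] [Fintype ι₁'] [Fintype ι₂] [DecidableEq ι₁] [DecidableEq ι₂]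
  (eJ : Fin n × Fin 2 ≃ ι₁) (eJ' : Fin n × Fin 2 ≃ ι₁') (eA : Fin 2 ⊕ ι₂ ≃ ι₁) {d : F} (hd : ¬ IsSquare d)
  (Zm : (ι₁' → F) → ((Fin 2 → F) →ₗ[F] (ι₁ → F)))
  (hZm : ∀ (s : ι₁' → F) (ζ : Fin 2 → F) (j : Fin n),
    Zm s ζ (eJ (j, 0)) = ζ 0 * s (eJ' (j, 0)) + d * ζ 1 * s (eJ' (j, 1)) ∧
    Zm s ζ (eJ (j, 1)) = ζ 0 * s (eJ' (j, 1)) + ζ 1 * s (eJ' (j, 0)))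

include hd hZm in
/-- **THE CONE CHART FRAMES AT ONE SLOT EQUIVALENCE.**  For the quadratic-coordinate multiplication graph `Z_s` (`hZm`, `d` not a square) and the consumer's
ONE `eA : Fin 2 ⊕ ι₂ ≃ ι₁`, there is a family of frames `A_s ∈ GL(F^{ι₁})` with
(i) `hA`: `∀ s ≠ 0, ∀ t ζ, A_s t ⬝ᵥ Z_s ζ = resL eA t ⬝ᵥ ζ` (★ p864562's letter);
(ii) `hres′` (SUPPORT LETTER): `A_s(0 ⊔ b) ∈ (𝔭^N)^{ι₁} ⇒ b ∈ (𝔭^N)^{ι₂}` for all `s, b, N`;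
(iii) `hAm`: `(s, b) ↦ A_s(0 ⊔ b)` is measurable;  (iv) `hdetm`: `s ↦ |det A_s|` is measurable.
Chart `j(s)` = the first `E_w`-coordinate with `s_j ≠ 0`; there the minor `!![x_j, y_j; d y_j, x_j]` is invertible (anisotropy), ★ p864435 (an-3a) frames it at a slot
equivalence through `j`'s slots, and `transport_frame` moves it to `eA`; at `s = 0`, `A_0 := 1`.
[cite: WeilBNT1967, Chap. I §2, Th. 3 Cor. 3] [cite: KudlaRallis1994, §2 (2.10)–(2.12)] [cite: Omeara1963, §63B] -/
theorem exists_coneChartFrames :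
    ∃ A : (ι₁' → F) → ((ι₁ → F) ≃ₗ[F] (ι₁ → F)),
      (∀ s : ι₁' → F, s ≠ 0 → ∀ (t : ι₁ → F) (ζ : Fin 2 → F), A s t ⬝ᵥ Zm s ζ = resL eA t ⬝ᵥ ζ) ∧
      (∀ (s : ι₁' → F) (b : ι₂ → F) (N : ℤ), A s (glue eA 0 b) ∈ piPrimePowBall F ι₁ N → b ∈ piPrimePowBall F ι₂ N) ∧
      Measurable (fun p : (ι₁' → F) × (ι₂ → F) => A p.1 (glue eA 0 p.2)) ∧
      Measurable (fun s : ι₁' → F => normAbs F (LinearMap.det (A s : (ι₁ → F) →ₗ[F] (ι₁ → F)))) := by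
  classical
  haveI : T2Space F := (isLocalField F).toT2Space
  haveI : SecondCountableTopology F := secondCountableTopology_localField F
  -- (a) a slot equivalence through the two slots of each `E_w`-coordinate
  have hslot : ∀ j : Fin n, ∃ e' : Fin 2 ⊕ ι₂ ≃ ι₁, ∀ c, e' (Sum.inl c) = eJ (j, c) := fun j =>
    exists_slotEquiv eA ⟨fun c => eJ (j, c), fun c c' h => by simpa using eJ.injective h⟩
  choose e' he' using hslot
  -- (b) the minors of `Z_sᵀ` along `e′_j`
  set ZJ : Fin n → (ι₁' → F) → Matrix (Fin 2) (Fin 2) F :=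
    fun j s => !![s (eJ' (j, 0)), s (eJ' (j, 1)); d * s (eJ' (j, 1)), s (eJ' (j, 0))] with hZJdef
  set ZR : Fin n → (ι₁' → F) → Matrix (Fin 2) ι₂ F := fun j s => Matrix.of fun k i => Zm s (Pi.single k 1) (e' j (Sum.inr i)) with hZRdef
  have hZJ : ∀ j s k k', ZJ j s k k' = Zm s (Pi.single k 1) (e' j (Sum.inl k')) := fun j s k k' =>
    minor_apply eJ eJ' d Zm hZm s j (e' j) (he' j) k k'
  have hZR : ∀ j s k i, ZR j s k i = Zm s (Pi.single k 1) (e' j (Sum.inr i)) := fun _ _ _ _ => rfl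
  have hdetZJ : ∀ j s, (ZJ j s).det = s (eJ' (j, 0)) ^ 2 - d * s (eJ' (j, 1)) ^ 2 := fun j s => det_minor d _ _
  have hunit : ∀ j s, ¬ (s (eJ' (j, 0)) = 0 ∧ s (eJ' (j, 1)) = 0) → IsUnit (ZJ j s).det := fun j s h => by
    rw [isUnit_iff_ne_zero, hdetZJ]; exact fun h0 => h (eq_zero_of_sq_sub_mul_sq_eq_zero hd h0)
  -- (c) the chart frames (★ (an-3a)), junk where the minor is singular
  have hfr : ∀ (j : Fin n) (s : ι₁' → F), ∃ A' : (ι₁ → F) ≃ₗ[F] (ι₁ → F), ¬ (s (eJ' (j, 0)) = 0 ∧ s (eJ' (j, 1)) = 0) →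
      (∀ (t : ι₁ → F) (ζ : Fin 2 → F), A' t ⬝ᵥ Zm s ζ = resL (e' j) t ⬝ᵥ ζ) ∧
      (∀ t : ι₁ → F, A' t = glue (e' j) ((ZJ j s)⁻¹ *ᵥ (resL (e' j) t - ZR j s *ᵥ resR (e' j) t)) (resR (e' j) t)) ∧
      LinearMap.det (A' : (ι₁ → F) →ₗ[F] (ι₁ → F)) = ((ZJ j s).det)⁻¹ := by
    intro j s
    by_cases h : ¬ (s (eJ' (j, 0)) = 0 ∧ s (eJ' (j, 1)) = 0)
    · obtain ⟨A', h1, h2, -, h4⟩ :=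
        K2LiuAdaptedFrameOfMinor.exists_adaptedFrame (e' j) (Zm s) (ZJ j s) (hZJ j s) (ZR j s) (hZR j s) (hunit j s h)
      exact ⟨A', fun _ => ⟨h1, h2, h4⟩⟩
    · exact ⟨LinearEquiv.refl F _, fun h' => (h h').elim⟩
  choose A' hA' using hfr
  -- (d) the chart selector: the first `E_w`-coordinate `j` with `s_j ≠ 0` (`none` iff `s = 0`), through a countable pattern space
  set good : Fin n → Set (ι₁' → F) := fun j => {s | ¬ (s (eJ' (j, 0)) = 0 ∧ s (eJ' (j, 1)) = 0)} with hgood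
  have hgoodm : ∀ j, MeasurableSet (good j) := fun j => by
    have h0 : MeasurableSet ((fun s : ι₁' → F => s (eJ' (j, 0))) ⁻¹' {0}) := measurable_pi_apply _ (measurableSet_singleton _)
    have h1 : MeasurableSet ((fun s : ι₁' → F => s (eJ' (j, 1))) ⁻¹' {0}) := measurable_pi_apply _ (measurableSet_singleton _)
    exact (h0.inter h1).compl
  set pat : (ι₁' → F) → (Fin n → ℕ) := fun s j => (good j).indicator (fun _ => (1 : ℕ)) s with hpat
  have hpatm : Measurable pat := measurable_pi_iff.2 fun j => measurable_const.indicator (hgoodm j)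
  have hpat1 : ∀ s j, pat s j = 1 ↔ s ∈ good j := fun s j => by by_cases h : s ∈ good j <;> simp [hpat, h]
  set G : (Fin n → ℕ) → Option (Fin n) := fun w =>
    if h : (Finset.univ.filter fun j => w j = 1).Nonempty then some ((Finset.univ.filter fun j => w j = 1).min' h) else none with hG
  set sel : (ι₁' → F) → Option (Fin n) := fun s => G (pat s) with hsel
  have hselm : ∀ o, MeasurableSet (sel ⁻¹' {o}) := fun o => hpatm (Set.to_countable (G ⁻¹' {o})).measurableSet
  have hsel_some : ∀ s j, sel s = some j → s ∈ good j := by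
    intro s j h
    simp only [hsel, hG] at h
    split_ifs at h with hne
    have hmem := Finset.min'_mem _ hne
    rw [Option.some_inj.1 h, Finset.mem_filter] at hmem
    exact (hpat1 s j).1 hmem.2
  have hsel_ne : ∀ s, s ≠ 0 → ∃ j, sel s = some j := by
    intro s hs
    have hex : ∃ j, s ∈ good j := by
      by_contra hno
      push Not at hno
      refine hs (funext fun i => ?_)
      obtain ⟨⟨j, c⟩, rfl⟩ := eJ'.surjective i
      have hj : s (eJ' (j, 0)) = 0 ∧ s (eJ' (j, 1)) = 0 := by simpa [hgood] using hno j
      fin_cases c <;> first | simpa using hj.1 | simpa using hj.2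
    obtain ⟨j, hj⟩ := hex
    have hne : (Finset.univ.filter fun j => pat s j = 1).Nonempty := ⟨j, Finset.mem_filter.2 ⟨Finset.mem_univ _, (hpat1 s j).2 hj⟩⟩
    exact ⟨(Finset.univ.filter fun j => pat s j = 1).min' hne, by simp only [hsel, hG, dif_pos hne]⟩
  -- (e) the frames at `eA`
  set P : Fin n → ((ι₁ → F) ≃ₗ[F] (ι₁ → F)) := fun j => LinearEquiv.funCongrLeft F F ((e' j).symm.trans eA) with hP
  set A : (ι₁' → F) → ((ι₁ → F) ≃ₗ[F] (ι₁ → F)) := fun s => (sel s).elim (LinearEquiv.refl F _) fun j => (P j).trans (A' j s) with hA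
  have hA_some : ∀ s j, sel s = some j → A s = (P j).trans (A' j s) := fun s j h => by simp only [hA, h, Option.elim_some]
  have hA_none : ∀ s, sel s = none → A s = LinearEquiv.refl F _ := fun s h => by simp only [hA, h, Option.elim_none]
  -- the fibre point on chart `j`
  have hfib : ∀ s j, sel s = some j → ∀ b : ι₂ → F,
      A s (glue eA 0 b) = glue (e' j) ((ZJ j s)⁻¹ *ᵥ (-(ZR j s *ᵥ b))) b := by
    intro s j h b
    rw [hA_some s j h, LinearEquiv.trans_apply, hP]; dsimp only
    rw [transport_glue, (hA' j s (hsel_some s j h)).2.1, resL_glue, resR_glue, zero_sub, Matrix.mulVec_neg]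
  refine ⟨A, ?_, ?_, ?_, ?_⟩
  · -- (i) adaptedness off the vertex
    intro s hs t ζ
    obtain ⟨j, hj⟩ := hsel_ne s hs
    rw [hA_some s j hj]
    exact transport_frame eA (e' j) (hA' j s (hsel_some s j hj)).1 t ζ
  · -- (ii) the support letter: the fibre coordinate is recovered at the chart's slots
    intro s b N hmem
    rcases h : sel s with _ | j
    · rw [hA_none s h, LinearEquiv.refl_apply] at hmem
      simpa using ((mem_piPrimePowBall_iff_resL_resR F eA _).1 hmem).2
    · rw [hfib s j h b] at hmem
      simpa using ((mem_piPrimePowBall_iff_resL_resR F (e' j) _).1 hmem).2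
  · -- (iii) measurability of `(s, b) ↦ A_s(0 ⊔ b)`: piecewise over the charts
    let Ψ : Option (Fin n) → ((ι₁' → F) × (ι₂ → F)) → (ι₁ → F) := fun o p =>
      o.elim (glue eA 0 p.2) fun j => glue (e' j) ((ZJ j p.1)⁻¹ *ᵥ (-(ZR j p.1 *ᵥ p.2))) p.2
    have hΨeq : (fun p : (ι₁' → F) × (ι₂ → F) => A p.1 (glue eA 0 p.2)) = fun p => Ψ (sel p.1) p := by
      funext p
      rcases h : sel p.1 with _ | j
      · rw [hA_none p.1 h, LinearEquiv.refl_apply]; rfl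
      · rw [hfib p.1 j h p.2]; rfl
    rw [hΨeq]
    refine measurable_select (fun p : (ι₁' → F) × (ι₂ → F) => sel p.1) (fun o => measurable_fst (hselm o)) Ψ fun o => ?_
    rcases o with _ | j
    · change Measurable fun p : (ι₁' → F) × (ι₂ → F) => glue eA 0 p.2
      exact (continuous_glue eA).measurable.comp (measurable_const.prodMk measurable_snd)
    · change Measurable fun p : (ι₁' → F) × (ι₂ → F) => glue (e' j) ((ZJ j p.1)⁻¹ *ᵥ (-(ZR j p.1 *ᵥ p.2))) p.2
      -- the `κ`-part `(ZJ_j(s))⁻¹ *ᵥ (−ZR_j(s) *ᵥ b)`: entries rational in `(s, b)` (`inv_minor_mulVec`)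
      have hx : Measurable fun p : (ι₁' → F) × (ι₂ → F) => p.1 (eJ' (j, 0)) := (measurable_pi_apply (eJ' (j, 0))).comp measurable_fst
      have hy : Measurable fun p : (ι₁' → F) × (ι₂ → F) => p.1 (eJ' (j, 1)) := (measurable_pi_apply (eJ' (j, 1))).comp measurable_fst
      have hN : Measurable fun p : (ι₁' → F) × (ι₂ → F) => (p.1 (eJ' (j, 0)) ^ 2 - d * p.1 (eJ' (j, 1)) ^ 2)⁻¹ :=
        measurable_inv.comp ((hx.pow_const 2).sub ((hy.pow_const 2).const_mul d))
      have hZRm : ∀ k i, Measurable fun p : (ι₁' → F) × (ι₂ → F) => ZR j p.1 k i := fun k i =>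
        (continuous_zm_apply eJ eJ' d Zm hZm (Pi.single k 1) (e' j (Sum.inr i))).measurable.comp measurable_fst
      have hw : ∀ k, Measurable fun p : (ι₁' → F) × (ι₂ → F) => (-(ZR j p.1 *ᵥ p.2)) k := by
        intro k
        simp only [Pi.neg_apply, Matrix.mulVec, dotProduct]
        exact (Finset.measurable_sum _ fun i _ => (hZRm k i).mul ((measurable_pi_apply i).comp measurable_snd)).neg
      have hform : (fun p : (ι₁' → F) × (ι₂ → F) => (ZJ j p.1)⁻¹ *ᵥ (-(ZR j p.1 *ᵥ p.2))) = fun p =>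
          ![(p.1 (eJ' (j, 0)) ^ 2 - d * p.1 (eJ' (j, 1)) ^ 2)⁻¹ *
              (p.1 (eJ' (j, 0)) * (-(ZR j p.1 *ᵥ p.2)) 0 - p.1 (eJ' (j, 1)) * (-(ZR j p.1 *ᵥ p.2)) 1),
            (p.1 (eJ' (j, 0)) ^ 2 - d * p.1 (eJ' (j, 1)) ^ 2)⁻¹ *
              (p.1 (eJ' (j, 0)) * (-(ZR j p.1 *ᵥ p.2)) 1 - d * p.1 (eJ' (j, 1)) * (-(ZR j p.1 *ᵥ p.2)) 0)] :=
        funext fun p => inv_minor_mulVec d _ _ _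
      have hmeas : Measurable fun p : (ι₁' → F) × (ι₂ → F) =>
          ![(p.1 (eJ' (j, 0)) ^ 2 - d * p.1 (eJ' (j, 1)) ^ 2)⁻¹ *
              (p.1 (eJ' (j, 0)) * (-(ZR j p.1 *ᵥ p.2)) 0 - p.1 (eJ' (j, 1)) * (-(ZR j p.1 *ᵥ p.2)) 1),
            (p.1 (eJ' (j, 0)) ^ 2 - d * p.1 (eJ' (j, 1)) ^ 2)⁻¹ *
              (p.1 (eJ' (j, 0)) * (-(ZR j p.1 *ᵥ p.2)) 1 - d * p.1 (eJ' (j, 1)) * (-(ZR j p.1 *ᵥ p.2)) 0)] := by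
        refine measurable_pi_iff.2 fun k => ?_
        fin_cases k
        · exact hN.mul ((hx.mul (hw 0)).sub (hy.mul (hw 1)))
        · exact hN.mul ((hx.mul (hw 1)).sub ((hy.const_mul d).mul (hw 0)))
      have hk : Measurable fun p : (ι₁' → F) × (ι₂ → F) => (ZJ j p.1)⁻¹ *ᵥ (-(ZR j p.1 *ᵥ p.2)) := hform ▸ hmeas
      exact (continuous_glue (e' j)).measurable.comp (hk.prodMk measurable_snd)
  · -- (iv) measurability of `s ↦ |det A_s|`: `|N(s_j)|⁻¹ · |det P_j|` on chart `j`, `1` at the vertex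
    let ψ : Option (Fin n) → (ι₁' → F) → ℝ≥0 := fun o s =>
      o.elim 1 fun j => normAbs F ((s (eJ' (j, 0)) ^ 2 - d * s (eJ' (j, 1)) ^ 2)⁻¹ *
        LinearMap.det (P j : (ι₁ → F) →ₗ[F] (ι₁ → F)))
    have hψeq : (fun s : ι₁' → F => normAbs F (LinearMap.det (A s : (ι₁ → F) →ₗ[F] (ι₁ → F)))) = fun s => ψ (sel s) s := by
      funext s
      rcases h : sel s with _ | j
      · rw [hA_none s h, LinearEquiv.refl_toLinearMap, LinearMap.det_id, map_one]; rfl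
      · rw [hA_some s j h, LinearEquiv.coe_trans, LinearMap.det_comp, (hA' j s (hsel_some s j h)).2.2, hdetZJ]; rfl
    rw [hψeq]
    refine measurable_select sel hselm ψ fun o => ?_
    rcases o with _ | j
    · exact measurable_const
    · change Measurable fun s : ι₁' → F => normAbs F ((s (eJ' (j, 0)) ^ 2 - d * s (eJ' (j, 1)) ^ 2)⁻¹ *
        LinearMap.det (P j : (ι₁ → F) →ₗ[F] (ι₁ → F)))
      have hx1 : Measurable fun s : ι₁' → F => s (eJ' (j, 0)) := measurable_pi_apply _
      have hy1 : Measurable fun s : ι₁' → F => s (eJ' (j, 1)) := measurable_pi_apply _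
      refine LocalFieldHaar.measurable_normAbs.comp ?_
      exact (measurable_inv.comp ((hx1.pow_const 2).sub ((hy1.pow_const 2).const_mul d))).mul_const _

end Frames

end Summit.HodgeConjecture.HodgeConjecture.Cruxes.HLiu418.K2LiuConeChartFrames

end
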